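import Summits.ResolutionOfSingularities.ResolutionOfSingularities.Theorems.HilbertSamuelEliminationCampaignW42ToricMarkedLinkMoves
import Summits.ResolutionOfSingularities.ResolutionOfSingularities.Theorems.HilbertSamuelEliminationCampaignW42ToricMarkedAssembly

/-!
# [OURS · L1 W4.2] Toric marked monomial objects in dimension 3 — brick 5B (part 2b): THE POTENTIAL DROPS UNDER A POINT MOVE

[OURS · L1 W4.2 · seat res-L1-s42-pv-2 gen 5] Memo `L/res-L1-s42-pv-2/CALIBRATION-W42-O2-v4.md` §3 (F6), (Q2) half: in the phase of residual order
`θs > 0`, when an unresolved `θs`-corner `C` NONE OF WHOSE 2-FACES IS ADMISSIBLE is blown up (procedure Q performs point moves only then), every child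
`D` of `C` that is again a `θs`-corner satisfies `Λ(D) < Λ(C)` (`Lam_lt_of_point_move`): the replaced ray is not a maximal-contact ray (brick 3), so
either `K` grows, or the child reads its potential at the same `k = k(C)` where the configuration of `𝒞_k` is replaced by its image under a child map of
the polyhedra game (brick 5B part 1); then the pair-width potential drops (brick 4A `T_child2_lt`) or, on a principal configuration, it stays `0` and the
minimum sum drops because the link ray is reduced (`{k, j}` not admissible ⇔ `β₂(j̄) < θs·L`, brick 5A; `minsum_child2_lt`, brick 4A).  Together with
`Lam_lt_of_curve_move` this is the per-move decrease of the existence proof; the Dershowitz–Manna descent (`PhaseLemma`) is the last step.  NOT a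
statement of the manuscript under review nor of Blanco / Encinas–Villamayor.  AI work, weaker than expert review.  Pure proofs, no `sorry`, no new axiom.
-/

set_option linter.dupNamespace false -- mandated namespace of this single-conjunct summit

namespace Summit.ResolutionOfSingularities.ResolutionOfSingularities.Theorems.CampaignW42.Toric

namespace TState

open Finset

variable {ι : Type} [Fintype ι] [Nonempty ι] [DecidableEq ι]

/-- `β₂` of a link ray whose scaled exponents are given by `f` on the (unchanged) generator set. -/
theorem bmin2_eq_inf'_of {m : ℕ} {s s' : TState ι} {θs L : ℤ} {k k' r' : ℕ} (hne : (s.G2 m θs k).Nonempty)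
    (hG : s'.G2 m θs k' = s.G2 m θs k) {f : Option ι → ℤ} (hE : ∀ g ∈ s.G2 m θs k, s'.E2 m θs L k' r' g = f g) :
    s'.bmin2 m θs L k' r' = (s.G2 m θs k).inf' hne f := by
  have hne' : (s'.G2 m θs k').Nonempty := by rw [hG]; exact hne
  unfold bmin2; rw [dif_pos hne']
  apply le_antisymm
  · obtain ⟨g, hg, hgeq⟩ := Finset.exists_mem_eq_inf' hne f
    rw [hgeq, ← hE g hg]; exact Finset.inf'_le _ (by rw [hG]; exact hg)
  · obtain ⟨g, hg, hgeq⟩ := Finset.exists_mem_eq_inf' hne' (s'.E2 m θs L k' r')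
    have hg' : g ∈ s.G2 m θs k := by rw [← hG]; exact hg
    rw [hgeq, hE g hg']; exact Finset.inf'_le _ hg'

/-- Lexicographic comparison helper for `Lam`: smaller first component. -/
private theorem lam_lt_of_fst' {a a' : ℕ} {p p' : ℕ ×ₗ ℕ} (h : a' < a) : (toLex (a', p') : ℕ ×ₗ (ℕ ×ₗ ℕ)) < toLex (a, p) :=
  Prod.Lex.lt_iff.mpr (Or.inl h)

/-- Lexicographic comparison helper for `Lam`: equal first component, smaller second. -/
private theorem lam_lt_of_snd {a t t' q q' : ℕ} (h : t' < t) :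
    (toLex (a, toLex (t', q')) : ℕ ×ₗ (ℕ ×ₗ ℕ)) < toLex (a, toLex (t, q)) :=
  Prod.Lex.lt_iff.mpr (Or.inr ⟨rfl, Prod.Lex.lt_iff.mpr (Or.inl h)⟩)

/-- Lexicographic comparison helper for `Lam`: equal first and second components, smaller third. -/
private theorem lam_lt_of_thd' {a t q q' : ℕ} (h : q' < q) :
    (toLex (a, toLex (t, q')) : ℕ ×ₗ (ℕ ×ₗ ℕ)) < toLex (a, toLex (t, q)) :=
  Prod.Lex.lt_iff.mpr (Or.inr ⟨rfl, Prod.Lex.lt_iff.mpr (Or.inr ⟨rfl, h⟩)⟩)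

omit [Fintype ι] [Nonempty ι] [DecidableEq ι] in
/-- The number of incomparable pairs is non-negative. -/
private theorem N_nonneg' {γ : Type} (G : Finset γ) (x y : γ → ℤ) : 0 ≤ PairPot.N G x y :=
  Finset.sum_nonneg (fun g _ => Finset.sum_nonneg (fun g' _ => PairPot.ind_nonneg x y g g'))

/-- **(Q2) THE POTENTIAL DROPS UNDER A POINT MOVE.**  In the phase of residual order `θs > 0`, blow up a `θs`-corner `C` none of whose 2-faces is
admissible (procedure Q performs point moves only in that situation); every child `D` of `C` that is again a `θs`-corner satisfies
`Λ(D) < Λ(C)`: either `K` grows, or — reading both at `k = k(C)` — the configuration of `𝒞_k` is replaced by its image under a child map of the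
polyhedra game, so the pair-width potential drops (`T_child2_lt`) or, on a principal configuration with reduced link ray (`{k, j}` not admissible),
the minimum sum drops (`minsum_child2_lt`). -/
theorem Lam_lt_of_point_move {m : ℕ} {s : TState ι} (hs : s.Nonneg) (hwf : s.WF) {θs L : ℤ} (hθ : 0 < θs)
    (hL : CommonMult m θs L) {C : Finset ℕ} (hC : C ∈ s.cones) (hθC : s.thetaR C = θs)
    (hnr : ¬ s.Resolved m C) (hnoadm : ∀ a ∈ C, ∀ b ∈ C, a ≠ b → ¬ s.Admissible m θs {a, b})
    {x : ℕ} (hx : x ∈ C) (hθD : (s.move m C).thetaR (insert s.next (C.erase x)) = θs) :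
    (s.move m C).Lam m θs L (insert s.next (C.erase x)) < s.Lam m θs L C := by
  have hnC : s.next ∉ C := hwf.next_notMem hC
  have hcard3 : C.card = 3 := (hwf C hC).1
  have hle : s.thetaR C ≤ s.thetaR C := le_rfl
  have hθCpos : 0 < s.thetaR C := by rw [hθC]; exact hθ
  -- the replaced ray is not a maximal-contact ray
  have hxK : x ∉ s.Kset C := by
    intro hxK
    have := thetaR_child_lt_of_mem_Kset (m := m) (subset_refl C) hle hxK hnC
    rw [hθD, hθC] at this; exact lt_irrefl _ this
  set k := s.kmin C with hkdef
  have hkK : k ∈ s.Kset C := kmin_mem hθCpos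
  have hkC : k ∈ C := s.Kset_subset C hkK
  have hkx : k ≠ x := fun h => hxK (h ▸ hkK)
  -- growth of K
  have hθD' : (s.move m C).thetaR (insert s.next (C.erase x)) = s.thetaR C := by rw [hθD, hθC]
  have hKD : s.Kset C ⊆ (s.move m C).Kset (insert s.next (C.erase x)) :=
    Kset_subset_Kset_child (subset_refl C) hle hx hxK hnC hθD'
  set D := insert s.next (C.erase x) with hDdef
  have hKcardC : (s.Kset C).card ≤ 2 := by
    have h1 : (s.Kset C).card < C.card := Finset.card_lt_card ⟨s.Kset_subset C, fun h => hxK (h hx)⟩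
    omega
  by_cases hgrow : (s.Kset C).card < ((s.move m C).Kset D).card
  · unfold Lam
    exact lam_lt_of_fst' (by omega)
  -- K(D) = K(C): same reading ray k
  have hKeq : (s.move m C).Kset D = s.Kset C :=
    (Finset.eq_of_subset_of_card_le hKD (le_of_not_gt hgrow)).symm
  have hkminD : (s.move m C).kmin D = k := by
    rw [hkdef]; unfold kmin; simp only [hKeq]
  -- the third ray j of C
  have hxCk : x ∈ C.erase k := Finset.mem_erase.mpr ⟨hkx.symm, hx⟩
  obtain ⟨j, hj⟩ : ∃ j, (C.erase k).erase x = {j} := Finset.card_eq_one.mp (by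
    rw [Finset.card_erase_of_mem hxCk, Finset.card_erase_of_mem hkC, hcard3])
  have hjmem : j ∈ (C.erase k).erase x := by rw [hj]; exact Finset.mem_singleton_self j
  have hjx : j ≠ x := (Finset.mem_erase.mp hjmem).1
  have hjk : j ≠ k := (Finset.mem_erase.mp (Finset.mem_erase.mp hjmem).2).1
  have hjC : j ∈ C := (Finset.mem_erase.mp (Finset.mem_erase.mp hjmem).2).2
  have hCe : C = {k, x, j} := by rw [← Finset.insert_erase hkC, ← Finset.insert_erase hxCk, hj]
  -- link data of the point move (child replacing `x`)
  obtain ⟨-, hTi, hG, hEn, -, hEj⟩ := link_data_point_move (m := m) hs hwf hL hkx hjk.symm hjx.symm hC hCe hθC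
  set G := s.G2 m θs k with hGdef
  set X : Option ι → ℤ := s.E2 m θs L k x with hXdef
  set Y : Option ι → ℤ := s.E2 m θs L k j with hYdef
  have hGne : G.Nonempty := s.G2_nonempty m hθ k
  have hkn : k ≠ s.next := fun h => hnC (h ▸ hkC)
  have hjn : j ≠ s.next := fun h => hnC (h ▸ hjC)
  have hxn : x ≠ s.next := fun h => hnC (h ▸ hx)
  have hCk : C.erase k = {x, j} := by
    rw [hCe]; ext r; simp only [Finset.mem_erase, Finset.mem_insert, Finset.mem_singleton]; omega
  have hDk : D.erase k = {s.next, j} := by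
    rw [hDdef, hCe]; ext r
    simp only [Finset.mem_erase, Finset.mem_insert, Finset.mem_singleton]; omega
  -- linkT and psum2 of C and D in configuration form
  have hTC : s.linkT m θs L k C = PairPot.T G X Y := linkT_eq hjx.symm hCk
  have hTD : (s.move m C).linkT m θs L k D = PairPot.T G (fun g => X g + Y g - θs * L) Y := hTi
  have hPC : s.psum2 m θs L k C = G.inf' hGne X + G.inf' hGne Y := by
    unfold psum2; rw [hCk, Finset.sum_pair hjx.symm]
    rw [bmin2_eq_inf'_of (s' := s) hGne rfl (fun g _ => rfl), bmin2_eq_inf'_of (s' := s) hGne rfl (fun g _ => rfl)]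
  have hPD : (s.move m C).psum2 m θs L k D = G.inf' hGne (fun g => X g + Y g - θs * L) + G.inf' hGne Y := by
    unfold psum2; rw [hDk, Finset.sum_pair hjn.symm]
    rw [bmin2_eq_inf'_of hGne hG hEn, bmin2_eq_inf'_of hGne hG hEj]
  -- legality of the point move, non-negativity of the child state
  have hlegal : s.Legal m C := (admissible_self hC ⟨x, hx⟩ hθC hnr).legal hs
  have hs' : (s.move m C).Nonneg := hs.move hlegal
  have hTC0 : 0 ≤ PairPot.T G X Y := PairPot.T_nonneg _ _ _
  unfold Lam
  rw [hKeq, hkminD, ← hkdef, hTD, hTC, hPD, hPC]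
  by_cases hT : 0 < PairPot.T G X Y
  · -- the pair-width potential drops
    have hlt := PairPot.T_child2_lt G X Y (θs * L) hT
    exact lam_lt_of_snd ((Int.toNat_lt_toNat hT).mpr hlt)
  · -- principal configuration: T stays 0 and the minimum sum drops (reduced link ray j)
    have hT0 : PairPot.T G X Y = 0 := le_antisymm (le_of_not_gt hT) hTC0
    obtain ⟨g₀, hg₀, hmin⟩ := PairPot.exists_min_of_T_eq_zero G hGne X Y hT0
    have hT'0 : PairPot.T G (fun g => X g + Y g - θs * L) Y = 0 := by
      have h1 := PairPot.T_child2_add_N_le G X Y (θs * L)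
      have h2 := N_nonneg' G X Y
      have h3 := PairPot.T_nonneg G (fun g => X g + Y g - θs * L) Y
      omega
    rw [hT0, hT'0]
    apply lam_lt_of_thd'
    have hkjC : ({k, j} : Finset ℕ) ⊆ C := by
      intro r hr
      simp only [Finset.mem_insert, Finset.mem_singleton] at hr
      rcases hr with rfl | rfl
      · exact hkC
      · exact hjC
    have hface : s.IsFace {k, j} := ⟨⟨k, by simp⟩, C, hC, hkjC⟩
    have hlekj : s.thetaR {k, j} ≤ θs := by rw [← hθC]; exact s.thetaR_mono hkjC
    have hred : s.bmin2 m θs L k j < θs * L :=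
      (bmin2_lt_iff_not_admissible hs hθ hL hjk.symm hface hlekj).mpr (hnoadm k hkC j hjC hjk.symm)
    have hbj : s.bmin2 m θs L k j = Y g₀ := by
      unfold bmin2; rw [dif_pos hGne]
      exact le_antisymm (Finset.inf'_le _ hg₀) (Finset.le_inf' _ _ (fun g hg => (hmin g hg).2))
    have hredY : Y g₀ < θs * L := by rw [← hbj]; exact hred
    have hlt := PairPot.minsum_child2_lt G X Y (θs * L) hg₀ hmin hredY
    have hP0 : 0 ≤ G.inf' hGne (fun g => X g + Y g - θs * L) + G.inf' hGne Y := by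
      rw [← hPD]; exact psum2_nonneg hs' hθ hL k D
    have hPpos : 0 < G.inf' hGne X + G.inf' hGne Y := lt_of_le_of_lt hP0 hlt
    exact (Int.toNat_lt_toNat hPpos).mpr hlt

end TState

end Summit.ResolutionOfSingularities.ResolutionOfSingularities.Theorems.CampaignW42.Toric
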